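import Literature.NumberTheory.LFunctions.KMVMomentsToHalfEdgeRootsPB
import Literature.NumberTheory.LFunctions.IwaniecSarnakFamilyWeightTwoPeterssonPB
import HarnessLib

/-!
# Mollified moments ⇒ the ½-proportion edge at prime level, RE-THREADED to the Petersson bound in its printed range
# (`kowalskiMichel2000_peterssonBound`; twins of `KMVMomentsToHalfEdge` §7 and §9)

Topic `Literature/NumberTheory/LFunctions` (namespace `…CentralValueFamilyHalfEdge`, as the originals). PROOFS only — no
definition, no named fact (D-0026). Cell landau-siegel, D-0124 rescue W1 event R2-G44 (director-frontier 2026-08-27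
11:41:46Z / 11:56:05Z, re-thread file F4, pass-throughs #13 #14 #17), typer seat ls-rescue-typ-1.

WHY. `KowalskiMichel2000.kowalskiMichel2000_petersson` (KM2000 p. 310 typed for ALL `m, n ≥ 1`) is FALSE AS TYPED
(`KowalskiMichel2000.not_kowalskiMichel2000_petersson`); the print is fine; the repaired fact of record is
`KowalskiMichel2000.kowalskiMichel2000_peterssonBound` (extra binder `¬ (q ∣ m ∧ q ∣ n)`). Here the §7/§9 theorems of
`KMVMomentsToHalfEdge` carrying `(hP : kowalskiMichel2000_petersson)` get ADDITIVE twins `…_pb` with the binder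
`(hP : KowalskiMichel2000.kowalskiMichel2000_peterssonBound)`, statements otherwise IDENTICAL, proofs = the originals with
the consumed lemmas replaced by their twins: the masses `abs_totalMass_sub_one_le_pb` /
`abs_two_mul_evenMass_sub_totalMass_le_pb` (F2, `IwaniecSarnakFamilyWeightTwoPeterssonPB`, instantiations `(1,1)`, `(q,1)`)
and the norm shape `KMV2000.mollifierNormBound_of_petersson_pb` (F4 roots, `KMVMomentsToHalfEdgeRootsPB`, p532006).
Originals untouched; nothing here uses `¬ kowalskiMichel2000_petersson` (no ex falso — smuggling rule).
«refuted-as-typed ≠ refuted-in-print» · «The programme SEARCHES and TYPES; no claim about Landau–Siegel zeros,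
Theorems 1–2 of arXiv:2211.02515 or a repaired Margin232 until a kernel theorem says so.»

## References

* [KowalskiMichelVanderKam2000] E. Kowalski, P. Michel, J. VanderKam, J. reine angew. Math. 526 (2000), §1 (after (7)),
  §2 p. 7, §6 p. 19, Thm. 6.1 (32), (9).
* [IwaniecConversations2006] H. Iwaniec, LNM 1891 (2006), §7 (7.5) and p. 97.
* [KowalskiMichel2000] E. Kowalski, P. Michel, Acta Arith. 94 (2000), §2.3 p. 310 (display after (16)).
* Tree: `KMVMomentsToHalfEdge` (p482721 + Part 2), `IwaniecSarnakFamilyWeightTwoPeterssonPB` (p531367), `KMVMomentsToHalfEdgeRootsPB` (p532006).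
-/

noncomputable section

open scoped Real
open Finset Complex Polynomial CongruenceSubgroup
open Literature.NumberTheory.EllipticCurves.ModularForms

namespace Literature.NumberTheory.LFunctions

/-! ## §7 twins: the ½-proportion edge for the weight-2 prime-level family -/

namespace CentralValueFamilyHalfEdge

open Filter _root_.Topology
open Literature.NumberTheory.LFunctions.IwaniecSarnak

/-- **Mollified moments beyond the diagonal ⇒ E*-fam at prime level, weight `2`** — twin of
`primeLevelFamilyTwo_EStarFam_of_momentAsymptotics` with the Petersson input in its printed range (masses via the F2 twins):
moment asymptotics on a window + admissible `P` with Cauchy–Schwarz value `R > ¼` + `q̂^Δ ∉ ℕ` eventually + the norm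
shape + non-negativity ⇒ `∃ p₁ > ½, primeLevelFamilyTwo.EStarFam p₁ 2` (`p₁ = R + ¼`).
[cite: IwaniecConversations2006, §7 (7.5) and p. 97] [cite: KowalskiMichelVanderKam2000, Thm. 6.1 and §6 p. 19] -/
theorem primeLevelFamilyTwo_EStarFam_of_momentAsymptotics_pb
    (hP : KowalskiMichel2000.kowalskiMichel2000_peterssonBound)
    (hLR : lapidRallis2003_theorem1_gl2Twist)
    {Δlo Δhi : ℝ} {T₁ T₂ : ℝ → ℝ[X] → ℝ[X] → ℝ} (hMA : KMV2000.MomentAsymptotics Δlo Δhi T₁ T₂)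
    {P : ℝ[X]} (hPadm : KMV2000.Admissible P) {Δ : ℝ} (hΔ : 0 < Δ) (hlo : Δlo < Δ)
    (hhi : Δ ≤ Δhi)
    (hgen : ∃ q₁ : ℕ, ∀ q : ℕ, q.Prime → q₁ ≤ q → ∀ n : ℕ, (n : ℝ) ≠ KMV2000.qhat q ^ Δ)
    (hnorm : ∃ C : ℝ, ∃ q₁ : ℕ, ∀ (q : ℕ) [NeZero q], q.Prime → q₁ ≤ q →
      harmonicSum q 2 (fun f ↦ ‖KMV2000.mollifierP q P (KMV2000.qhat q ^ Δ) f‖ ^ 2) ≤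
        C * Real.log (KMV2000.qhat q))
    (hc₂ : 0 < KMV2000.secondMomentForm Δ P 1 + T₂ Δ P 1)
    (hR : 1 / 4 < (KMV2000.linForm Δ P 1 + T₁ Δ P 1) ^ 2 /
      (2 * (KMV2000.secondMomentForm Δ P 1 + T₂ Δ P 1))) :
    ∃ p₁ : ℝ, 1 / 2 < p₁ ∧ primeLevelFamilyTwo.EStarFam p₁ 2 := by
  set c₁ : ℝ := KMV2000.linForm Δ P 1 + T₁ Δ P 1 with hc₁_def
  set c₂ : ℝ := KMV2000.secondMomentForm Δ P 1 + T₂ Δ P 1 with hc₂_def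
  set R : ℝ := c₁ ^ 2 / (2 * c₂) with hR_def
  have hc₁ : c₁ ≠ 0 := by
    intro h
    rw [hR_def, h] at hR
    norm_num at hR
  set ε : ℝ := (4 * R - 1) / (8 * R + 10) with hε_def
  have hε : 0 < ε := div_pos (by linarith) (by linarith)
  have hε1 : ε ≤ 1 / 2 := by
    rw [hε_def, div_le_iff₀ (by linarith)]
    linarith
  obtain ⟨q₀, Hgood⟩ := KMV2000.goodMass_lower_of_momentAsymptotics hLR hMA hPadm hΔ hlo hhi hgen
    hnorm hc₁ hc₂ hε
  obtain ⟨Ct, Ht⟩ := abs_totalMass_sub_one_le_pb hP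
  obtain ⟨Ce, He⟩ := abs_two_mul_evenMass_sub_totalMass_le_pb hP
  -- the Petersson error terms are eventually `< ε`
  have hev : ∀ᶠ q : ℕ in atTop,
      Ct * (q : ℝ) ^ (-(3 / 2 : ℝ)) < ε ∧ Ce * (q : ℝ) ^ (-(1 / 4 : ℝ)) < ε := by
    have h1 : Tendsto (fun q : ℕ ↦ Ct * (q : ℝ) ^ (-(3 / 2 : ℝ))) atTop (𝓝 0) := by
      have h := ((tendsto_rpow_neg_atTop (by norm_num : (0 : ℝ) < 3 / 2)).comp
        tendsto_natCast_atTop_atTop).const_mul Ct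
      rw [mul_zero] at h
      exact h
    have h2 : Tendsto (fun q : ℕ ↦ Ce * (q : ℝ) ^ (-(1 / 4 : ℝ))) atTop (𝓝 0) := by
      have h := ((tendsto_rpow_neg_atTop (by norm_num : (0 : ℝ) < 1 / 4)).comp
        tendsto_natCast_atTop_atTop).const_mul Ce
      rw [mul_zero] at h
      exact h
    exact ((tendsto_order.1 h1).2 ε hε).and ((tendsto_order.1 h2).2 ε hε)
  obtain ⟨q₃, Hq₃⟩ := Filter.eventually_atTop.1 hev
  refine ⟨R + 1 / 4, by linarith, ((max q₀ q₃ : ℕ) : ℝ),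
    fun (N : ℕ+) (hadm : Squarefree (N : ℕ) ∧ (N : ℕ).Prime)
      (hsz : ((max q₀ q₃ : ℕ) : ℝ) ≤ ((N : ℕ) : ℝ)) ↦ ?_⟩
  have hN : max q₀ q₃ ≤ (N : ℕ) := by exact_mod_cast hsz
  have hNq₀ : q₀ ≤ (N : ℕ) := le_trans (le_max_left _ _) hN
  have hNq₃ : q₃ ≤ (N : ℕ) := le_trans (le_max_right _ _) hN
  obtain ⟨hW1, hE1⟩ := Hq₃ (N : ℕ) hNq₃
  have hprime : (N : ℕ).Prime := hadm.2
  have hWabs := Ht (N : ℕ) hprime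
  have hEabs := He (N : ℕ) hprime
  have hW2 : harmonicSum (N : ℕ) 2 (fun _ ↦ (1 : ℝ)) ≤ 2 := by
    have := (abs_le.1 hWabs).2
    linarith
  have hE : harmonicSum (N : ℕ) 2 (fun f ↦ if rootNumber f = 1 then (1 : ℝ) else 0) ≤
      1 / 2 + ε := by
    have h₁ := (abs_le.1 hEabs).2
    have h₂ := (abs_le.1 hWabs).2
    linarith
  have hgood := Hgood (N : ℕ) hprime hNq₀ hW2
  show (R + 1 / 4) * (iwaniecSarnakFamily 2).evenMass N ≤ (iwaniecSarnakFamily 2).goodMass 2 N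
  rw [evenMass_iwaniecSarnakFamily, goodMass_iwaniecSarnakFamily]
  have key : (R + 1 / 4) * (1 / 2 + ε) = R - ε := by
    rw [hε_def]
    field_simp
    ring
  calc (R + 1 / 4) * harmonicSum (N : ℕ) 2 (fun f ↦ if rootNumber f = 1 then (1 : ℝ) else 0)
      ≤ (R + 1 / 4) * (1 / 2 + ε) := mul_le_mul_of_nonneg_left hE (by linarith)
    _ = R - ε := key
    _ ≤ _ := hgood

/-- **Window form** — twin of `primeLevelFamilyTwo_EStarFam_of_momentAsymptotics_window` (generic `Δ` in the window
discharges KMV's side condition `q̂^Δ ∉ ℕ`). [cite: KowalskiMichelVanderKam2000, Thm. 6.1 and (9)]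
[cite: IwaniecConversations2006, §7 (7.5)] -/
theorem primeLevelFamilyTwo_EStarFam_of_momentAsymptotics_window_pb
    (hP : KowalskiMichel2000.kowalskiMichel2000_peterssonBound)
    (hLR : lapidRallis2003_theorem1_gl2Twist)
    {Δlo Δhi : ℝ} {T₁ T₂ : ℝ → ℝ[X] → ℝ[X] → ℝ} (hMA : KMV2000.MomentAsymptotics Δlo Δhi T₁ T₂)
    {P : ℝ[X]} (hPadm : KMV2000.Admissible P) {a b : ℝ} (ha : 0 ≤ a) (hab : a < b)
    (hlo : Δlo ≤ a) (hhi : b ≤ Δhi)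
    (hnorm : ∀ Δ ∈ Set.Ioo a b, ∃ C : ℝ, ∃ q₁ : ℕ, ∀ (q : ℕ) [NeZero q], q.Prime → q₁ ≤ q →
      harmonicSum q 2 (fun f ↦ ‖KMV2000.mollifierP q P (KMV2000.qhat q ^ Δ) f‖ ^ 2) ≤
        C * Real.log (KMV2000.qhat q))
    (hval : ∀ Δ ∈ Set.Ioo a b, 0 < KMV2000.secondMomentForm Δ P 1 + T₂ Δ P 1 ∧
      1 / 4 < (KMV2000.linForm Δ P 1 + T₁ Δ P 1) ^ 2 /
        (2 * (KMV2000.secondMomentForm Δ P 1 + T₂ Δ P 1))) :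
    ∃ p₁ : ℝ, 1 / 2 < p₁ ∧ primeLevelFamilyTwo.EStarFam p₁ 2 := by
  obtain ⟨Δ, hΔ, hgen⟩ := KMV2000.exists_mem_Ioo_qhat_rpow_ne_nat hab
  obtain ⟨hc₂, hR⟩ := hval Δ hΔ
  exact primeLevelFamilyTwo_EStarFam_of_momentAsymptotics_pb hP hLR hMA hPadm
    (lt_of_le_of_lt ha hΔ.1) (lt_of_le_of_lt hlo hΔ.1) (le_trans hΔ.2.le hhi)
    ⟨40, fun q _ hq ↦ hgen q hq⟩ (hnorm Δ hΔ) hc₂ hR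

end CentralValueFamilyHalfEdge

/-! ## §9 twin: the family route's conversion support with its printed inputs (Petersson in range) -/

namespace CentralValueFamilyHalfEdge

open Literature.NumberTheory.LFunctions.IwaniecSarnak

/-- **`EdgeOfBeyondDiagonalValue`, with its printed inputs displayed** — twin of
`primeLevelFamilyTwo_EStarFam_of_beyondDiagonalValue`: non-negativity (`lapidRallis2003_theorem1_gl2Twist`) → Petersson
IN ITS RANGE (`kowalskiMichel2000_peterssonBound`) → `∀ Δ > 1, ∀ T₁ T₂, KMV2000.MomentAsymptotics 1 Δ T₁ T₂ → ∀ b ∈ (1, Δ],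
∀ P admissible, (∀ Δ' ∈ (1, b), ¼ < value) → ∃ p₁ > ½, primeLevelFamilyTwo.EStarFam p₁ 2`.
[cite: KowalskiMichelVanderKam2000, Thm. 6.1 (32) and §6 p. 19] [cite: IwaniecConversations2006, §7 (7.5)] -/
theorem primeLevelFamilyTwo_EStarFam_of_beyondDiagonalValue_pb
    (hLR : lapidRallis2003_theorem1_gl2Twist)
    (hP : KowalskiMichel2000.kowalskiMichel2000_peterssonBound) :
    ∀ Δ : ℝ, 1 < Δ → ∀ T₁ T₂ : ℝ → Polynomial ℝ → Polynomial ℝ → ℝ,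
      KMV2000.MomentAsymptotics 1 Δ T₁ T₂ → ∀ b : ℝ, 1 < b → b ≤ Δ → ∀ P : Polynomial ℝ,
      KMV2000.Admissible P →
      (∀ Δ' : ℝ, 1 < Δ' → Δ' < b →
        1 / 4 < (KMV2000.linForm Δ' P 1 + T₁ Δ' P 1) ^ 2 /
          (2 * (KMV2000.secondMomentForm Δ' P 1 + T₂ Δ' P 1))) →
      ∃ p₁ : ℝ, 1 / 2 < p₁ ∧ primeLevelFamilyTwo.EStarFam p₁ 2 := by
  intro Δ _hΔ T₁ T₂ hMA b hb1 hbΔ P hPadm hval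
  -- one generic length in `(1, min b (3/2))`
  have hb' : (1 : ℝ) < min b (3 / 2) := lt_min hb1 (by norm_num)
  obtain ⟨Δ', ⟨h1Δ', hΔ'b⟩, hgen⟩ := KMV2000.exists_mem_Ioo_qhat_rpow_ne_nat hb'
  have hΔ'b' : Δ' < b := lt_of_lt_of_le hΔ'b (min_le_left _ _)
  have hΔ'32 : Δ' < 3 / 2 := lt_of_lt_of_le hΔ'b (min_le_right _ _)
  have hΔ'0 : 0 < Δ' := by linarith
  have hR := hval Δ' h1Δ' hΔ'b'
  -- the value inequality forces a positive second main term
  have hc₂ : 0 < KMV2000.secondMomentForm Δ' P 1 + T₂ Δ' P 1 := by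
    by_contra h
    have h := not_lt.1 h
    have : (KMV2000.linForm Δ' P 1 + T₁ Δ' P 1) ^ 2 /
        (2 * (KMV2000.secondMomentForm Δ' P 1 + T₂ Δ' P 1)) ≤ 0 :=
      div_nonpos_of_nonneg_of_nonpos (sq_nonneg _) (by linarith)
    linarith
  exact primeLevelFamilyTwo_EStarFam_of_momentAsymptotics_pb hP hLR hMA hPadm hΔ'0 h1Δ'
    (le_trans hΔ'b'.le hbΔ) ⟨40, fun q _ hq ↦ hgen q hq⟩
    (KMV2000.mollifierNormBound_of_petersson_pb hP P hΔ'0 hΔ'32) hc₂ hR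

end CentralValueFamilyHalfEdge

end Literature.NumberTheory.LFunctions
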